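import Mathlib
import Summits.ValiantsHypothesis.ValiantsHypothesis.Theorems.MonotoneRestorationMixingScaleNonResidual
import Summits.ValiantsHypothesis.ValiantsHypothesis.Theorems.MonotoneRestorationMixingScaleAlmostInvariantTerms
import Summits.ValiantsHypothesis.ValiantsHypothesis.Theorems.MonotoneRestorationMixingScaleAlternatingMinimalDegree
import HarnessLib

/-!
# Line `mixing-scale` (crux `OrbitRestorationQP`, stmt-ValiantsHypothesis-18293): the product-mixing input DISCHARGED

Route MonotoneRestoration, line `mixing-scale` (val-idea-12), namespace
`Summit.ValiantsHypothesis.ValiantsHypothesis.Theorems.OrbitRestorationQPMixingScale`.  The registered input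
`AlternatingMixing` of the line is the Literature fact `Literature.GroupTheory.QuasirandomGroups.alternatingProductMixing`
(Babai–Nikolov–Pyber product mixing in `𝔄_n`); it entered the landed chain BY NAME as the hypothesis `hmix` of
`stub_almostInvariantTerms` (M2), `growingFaninRestoration_of` (M5 assembly) and `productDepthRestorationQP_one_of_residual`.
It is now a THEOREM (`AlternatingMinimalDegree.alternatingProductMixing_holds`, from the discharge
`JamesKerber1981_thm_2_5_15_holds` of the minimal degree of `𝔄_n`), and this file records the chain with that hypothesis removed:

* `almostInvariantTerms_of_rankBound : depthThree_rankBound → AlmostInvariantTerms` (M2 from the Saxena–Seshadhri bound alone);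
* `growingFaninRestoration_of_rankBound : depthThree_rankBound → PiSigmaValue → GrowingFaninRestoration` (the new rung from
  the rank bound and A₁ alone);
* `productDepthRestorationQP_one_of_residual_of_rankBound` (the rung `ProductDepthRestorationQP 1` from the declared residual,
  the rank bound and A₁).

Remaining named inputs of the line: `depthThree_rankBound` (Saxena–Seshadhri 2013 Thm 5, UNPROVED in the tree), A₁ = `PiSigmaValue`
(OPEN sub-rung), and the declared residual `GrowingFaninResidual`.  Honest framing: CONDITIONAL results; the crux
`OrbitRestorationQP` (stmt-18293) is NOT closed and `VP ≠ VNP` is NOT proved or moved.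
[cite: SaxenaSeshadhri2013, Theorem 5]
-/

noncomputable section

open Literature.Computability.AlgebraicComplexity Literature.GroupTheory.QuasirandomGroups

-- `Summit.ValiantsHypothesis.ValiantsHypothesis.…` is the tree's single-conjunct layout (Sub = Summit).
set_option linter.dupNamespace false

namespace Summit.ValiantsHypothesis.ValiantsHypothesis.Theorems.OrbitRestorationQPMixingScale

open OrbitRestorationQPDepthThreeRung

/-- **M2 without the mixing hypothesis**: the Saxena–Seshadhri depth-three rank bound alone gives
`AlmostInvariantTerms` (product mixing in `𝔄_n` is now the theorem `alternatingProductMixing_holds`).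
[cite: SaxenaSeshadhri2013, Theorem 5] -/
theorem almostInvariantTerms_of_rankBound (hRB : depthThree_rankBound) : AlmostInvariantTerms :=
  stub_almostInvariantTerms AlternatingMinimalDegree.alternatingProductMixing_holds hRB

/-- **The new rung without the mixing hypothesis**: the depth-three rank bound + A₁ ⇒ restoration for
growing top fan-in. [cite: SaxenaSeshadhri2013, Theorem 5] -/
theorem growingFaninRestoration_of_rankBound (hRB : depthThree_rankBound) (hA1 : PiSigmaValue) :
    GrowingFaninRestoration :=
  growingFaninRestoration_of AlternatingMinimalDegree.alternatingProductMixing_holds hRB hA1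

/-- **The rung `ProductDepthRestorationQP 1` modulo the declared residual, without the mixing hypothesis.**
[cite: SaxenaSeshadhri2013, Theorem 5] -/
theorem productDepthRestorationQP_one_of_residual_of_rankBound (hres : GrowingFaninResidual)
    (hRB : depthThree_rankBound) (hA1 : PiSigmaValue) : ProductDepthRestorationQP (fun _ => 1) :=
  productDepthRestorationQP_one_of_residual hres AlternatingMinimalDegree.alternatingProductMixing_holds hRB hA1

end Summit.ValiantsHypothesis.ValiantsHypothesis.Theorems.OrbitRestorationQPMixingScale

end
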